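import Summits.CriticalPhenomena.PercolationContinuityZ3.Theorems.PercNearOneGluingNoHeavyConstsClusterSquareOuterplanarPos
import HarnessLib

/-!
# Gap lemmas for an outerplanar graph with one APEX (hub) inside a face: two-graph crossing lemma and hub contraction

builds on p205010 (kernel theorem, internal audit signed; external expert review pending)

PAPER-2 track "percolation constants", part (ii), seat `prim-consts-1`, gen 20 (lane index
`run/shared/lean/prim/consts/CONSTANTS.md`, row A19; memo `FROM-prim-consts-1-g20-APEX-FACE.md`).
Support file for the crux `NoHeavyLowerTail` (stmt-CriticalPhenomena-4575; `--supports`).  Theorems only; no definitions, no sorries.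

THE SETTING (used by `…ConstsClusterSquareApex.lean`).  `H` on `Fin n`, a HUB `h`, the other (RIM) vertices carry positions
`pos u : Fin m`, injective on the rim (`pos h` is never used).  Besides `H` two auxiliary graphs appear as PARAMETERS: a rim
graph `G₀` (containing every `H`-edge between rim vertices) and a hub-contracted graph `H'` (containing those edges and a
"virtual chord" `{u, v}` for every two rim neighbours `u ≠ v` of the hub).  The standing geometric hypothesis is that no
`H'`-edge crosses a `G₀`-edge in the cyclic order of the positions (for the intended `G₀, H'` this says: rim edges are pairwise
non-crossing, and no rim edge separates two hub-neighbours — the hub sits inside ONE face of the outerplanar rim graph).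

THE RESULTS.  (1) `Apex.cnt_eq_of_adj_lt₂` / `cnt_eq_of_adj₂`: the gap-count lemma of `…ClusterSquareOuterplanarPos` in TWO-GRAPH
form — a set `S` connected from the base point by `G₁`-walks, a tested `G₂`-edge between two vertices outside `S`, and the
hypothesis that no `G₁`-edge crosses a `G₂`-edge; then the two vertices lie in the same gap of `S` (same number of `S`-vertices
before them in the cut-open order).  (2) `Apex.contract`: every `H`-walk between rim vertices contracts to an `H'`-walk on the rim
part of its support (two consecutive hub edges `u ~ h ~ v` become the chord `u ~ v`); `Apex.toRim`: a hub-free `H`-walk is a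
`G₀`-walk.  (3) MASTER LEMMA `Apex.cnt_eq_of_walk`: if `S ∋ a` (`a` on the rim) is `H`-connected from `a` inside `S` and `W` is an
`H`-walk avoiding `S`, then all RIM vertices of `W` lie in the same gap of the rim part `{s ∈ S | s ≠ h}` of `S`.  Proof: a rim
step of `W` is a `G₀`-edge tested against the `H'`-connected rim part of `S` (contraction); a hub step `u ~ h ~ v` of `W` forces
`h ∉ S`, so `S` is `G₀`-connected and the chord `{u, v} ∈ H'` is tested against it — in both cases one side is `G₀`, the other
`H'`, which is exactly what the crossing hypothesis covers (two chords of the hub may cross each other; that case never arises).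
References: N. Gladkov, arXiv:2408.08457v2 (2024) (two-copy vdBK behind `…ClusterSquareUnlinked`); G. Chartrand, F. Harary,
Ann. Inst. H. Poincaré B 3 (1967) 433–438 (outerplanar graphs).
-/

noncomputable section

open Classical

namespace Summit.CriticalPhenomena.PercolationContinuityZ3.Theorems

open MeasureTheory Finset Literature.Probability.LatticeModels Literature.Probability.Percolation

namespace Consts

namespace Apex

variable {n m : ℕ} {pos : Fin n → Fin m} {h : Fin n}

/-! ### Two-graph crossing in the cut-open order -/

/-- If no `G₁`-edge crosses a `G₂`-edge (and vice versa) in the cyclic order of the positions, the same holds in the order cut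
open at any base point `o` (positions `(pos u - pos o).val`). [folklore] -/
theorem noncross_rot₂ {G₁ G₂ : SimpleGraph (Fin n)}
    (h12 : ∀ p q r s : Fin n, G₁.Adj p q → G₂.Adj r s → pos p < pos r → pos r < pos q → pos q < pos s → False)
    (h21 : ∀ p q r s : Fin n, G₂.Adj p q → G₁.Adj r s → pos p < pos r → pos r < pos q → pos q < pos s → False)
    (o : Fin n) {p q r s : Fin n} (hpq : G₁.Adj p q) (hrs : G₂.Adj r s)
    (h1 : (pos p - pos o).val < (pos r - pos o).val) (h2 : (pos r - pos o).val < (pos q - pos o).val)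
    (h3 : (pos q - pos o).val < (pos s - pos o).val) : False := by
  have hp := (pos p).isLt; have hq := (pos q).isLt; have hr := (pos r).isLt; have hs := (pos s).isLt
  simp only [NonCrossing.val_sub_eq] at h1 h2 h3
  have key : ((pos p : ℕ) < pos r ∧ (pos r : ℕ) < pos q ∧ (pos q : ℕ) < pos s) ∨
      ((pos r : ℕ) < pos q ∧ (pos q : ℕ) < pos s ∧ (pos s : ℕ) < pos p) ∨
      ((pos q : ℕ) < pos s ∧ (pos s : ℕ) < pos p ∧ (pos p : ℕ) < pos r) ∨
      ((pos s : ℕ) < pos p ∧ (pos p : ℕ) < pos r ∧ (pos r : ℕ) < pos q) := by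
    split_ifs at h1 h2 h3 <;> omega
  rcases key with ⟨a1, a2, a3⟩ | ⟨a1, a2, a3⟩ | ⟨a1, a2, a3⟩ | ⟨a1, a2, a3⟩
  · exact h12 p q r s hpq hrs a1 a2 a3
  · exact h21 r s q p hrs hpq.symm a1 a2 a3
  · exact h12 q p s r hpq.symm hrs.symm a1 a2 a3
  · exact h21 s r p q hrs.symm hpq a1 a2 a3

/-! ### The two-graph gap lemma -/

/-- KEY LEMMA, two-graph ordered form: `S` (avoiding the hub) is connected from `o` by `G₁`-walks inside `S`; `x, x'` are rim
vertices outside `S` joined by a `G₂`-edge; no `G₁`-edge crosses a `G₂`-edge in the order cut open at `o`.  Then `x, x'` have the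
same number of `S`-vertices before them. [folklore: discrete Jordan curve theorem on a cycle] -/
theorem cnt_eq_of_adj_lt₂ {G₁ G₂ : SimpleGraph (Fin n)} {o : Fin n}
    (hpos : ∀ u v, u ≠ h → v ≠ h → pos u = pos v → u = v)
    (h12 : ∀ p q r s : Fin n, G₁.Adj p q → G₂.Adj r s → (pos p - pos o).val < (pos r - pos o).val →
      (pos r - pos o).val < (pos q - pos o).val → (pos q - pos o).val < (pos s - pos o).val → False)
    (h21 : ∀ p q r s : Fin n, G₂.Adj p q → G₁.Adj r s → (pos p - pos o).val < (pos r - pos o).val →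
      (pos r - pos o).val < (pos q - pos o).val → (pos q - pos o).val < (pos s - pos o).val → False)
    {S : Set (Fin n)} (hSh : h ∉ S) (hS : ∀ s ∈ S, ∃ W : G₁.Walk o s, ∀ v ∈ W.support, v ∈ S)
    {x x' : Fin n} (hx : x ∉ S) (hx' : x' ∉ S) (hxh : x ≠ h) (hx'h : x' ≠ h) (hadj : G₂.Adj x x')
    (hlt : (pos x - pos o).val < (pos x' - pos o).val) :
    (Finset.univ.filter (fun s => s ∈ S ∧ (pos s - pos o).val < (pos x - pos o).val)).card =
      (Finset.univ.filter (fun s => s ∈ S ∧ (pos s - pos o).val < (pos x' - pos o).val)).card := by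
  by_contra hne
  -- some vertex of `S` lies strictly between `x` and `x'`
  obtain ⟨k₁, hk₁S, hk₁a, hk₁b⟩ : ∃ k₁ ∈ S, (pos x - pos o).val < (pos k₁ - pos o).val ∧
      (pos k₁ - pos o).val < (pos x' - pos o).val := by
    by_contra hno
    push Not at hno
    have hsub : Finset.univ.filter (fun s => s ∈ S ∧ (pos s - pos o).val < (pos x' - pos o).val) ⊆
        Finset.univ.filter (fun s => s ∈ S ∧ (pos s - pos o).val < (pos x - pos o).val) := by
      intro s hs
      rw [mem_filter] at hs ⊢
      refine ⟨hs.1, hs.2.1, ?_⟩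
      by_contra hge
      push Not at hge
      have hsh : s ≠ h := fun e => hSh (e ▸ hs.2.1)
      have hne' : (pos x - pos o).val ≠ (pos s - pos o).val := fun e =>
        hx (hpos x s hxh hsh (NonCrossing.rot_injective (pos o) e) ▸ hs.2.1)
      exact absurd hs.2.2 (not_lt.2 (hno s hs.2.1 (lt_of_le_of_ne hge hne')))
    have h1 := card_le_card hsub
    have h2 := NonCrossing.cnt_mono_pos (pos := pos) o S hlt.le
    omega
  -- an `S`-walk from `k₁` to `o` leaves the interval `(x, x')` through a crossing edge
  obtain ⟨W, hW⟩ := hS k₁ hk₁S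
  let A : Set (Fin n) := {v | (pos x - pos o).val < (pos v - pos o).val ∧ (pos v - pos o).val < (pos x' - pos o).val}
  have hk₁A : k₁ ∈ A := ⟨hk₁a, hk₁b⟩
  have hoA : o ∉ A := fun ho => by
    have h' : (pos x - pos o).val < (pos o - pos o).val := ho.1
    rw [NonCrossing.rot_self] at h'
    exact Nat.not_lt_zero _ h'
  obtain ⟨d, hd, hd1, hd2⟩ := W.reverse.exists_boundary_dart A hk₁A hoA
  have hvS : d.snd ∈ S := by
    refine hW _ ?_
    have := W.reverse.dart_snd_mem_support_of_mem_darts hd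
    rwa [SimpleGraph.Walk.support_reverse, List.mem_reverse] at this
  have hvh : d.snd ≠ h := fun e => hSh (e ▸ hvS)
  have hvx : (pos d.snd - pos o).val ≠ (pos x - pos o).val := fun e =>
    hx (hpos d.snd x hvh hxh (NonCrossing.rot_injective (pos o) e) ▸ hvS)
  have hvx' : (pos d.snd - pos o).val ≠ (pos x' - pos o).val := fun e =>
    hx' (hpos d.snd x' hvh hx'h (NonCrossing.rot_injective (pos o) e) ▸ hvS)
  have hu1 : (pos x - pos o).val < (pos d.fst - pos o).val := hd1.1
  have hu2 : (pos d.fst - pos o).val < (pos x' - pos o).val := hd1.2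
  have hd2' : ¬ ((pos x - pos o).val < (pos d.snd - pos o).val ∧ (pos d.snd - pos o).val < (pos x' - pos o).val) := hd2
  rcases not_and_or.1 hd2' with hle | hle
  · exact h12 d.snd d.fst x x' d.adj.symm hadj (lt_of_le_of_ne (not_lt.1 hle) hvx) hu1 hu2
  · exact h21 x x' d.fst d.snd hadj d.adj hu1 hu2 (lt_of_le_of_ne (not_lt.1 hle) (Ne.symm hvx'))

/-- KEY LEMMA, two-graph form: with `S`, `G₁`, `G₂` as in `Apex.cnt_eq_of_adj_lt₂`, two rim vertices outside `S` joined by a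
`G₂`-edge lie in the same gap of `S`. [folklore: discrete Jordan curve theorem on a cycle] -/
theorem cnt_eq_of_adj₂ {G₁ G₂ : SimpleGraph (Fin n)} {o : Fin n}
    (hpos : ∀ u v, u ≠ h → v ≠ h → pos u = pos v → u = v)
    (h12 : ∀ p q r s : Fin n, G₁.Adj p q → G₂.Adj r s → (pos p - pos o).val < (pos r - pos o).val →
      (pos r - pos o).val < (pos q - pos o).val → (pos q - pos o).val < (pos s - pos o).val → False)
    (h21 : ∀ p q r s : Fin n, G₂.Adj p q → G₁.Adj r s → (pos p - pos o).val < (pos r - pos o).val →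
      (pos r - pos o).val < (pos q - pos o).val → (pos q - pos o).val < (pos s - pos o).val → False)
    {S : Set (Fin n)} (hSh : h ∉ S) (hS : ∀ s ∈ S, ∃ W : G₁.Walk o s, ∀ v ∈ W.support, v ∈ S)
    {x x' : Fin n} (hx : x ∉ S) (hx' : x' ∉ S) (hxh : x ≠ h) (hx'h : x' ≠ h) (hadj : G₂.Adj x x') :
    (Finset.univ.filter (fun s => s ∈ S ∧ (pos s - pos o).val < (pos x - pos o).val)).card =
      (Finset.univ.filter (fun s => s ∈ S ∧ (pos s - pos o).val < (pos x' - pos o).val)).card := by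
  rcases lt_trichotomy ((pos x - pos o).val) ((pos x' - pos o).val) with hlt | heq | hgt
  · exact cnt_eq_of_adj_lt₂ hpos h12 h21 hSh hS hx hx' hxh hx'h hadj hlt
  · rw [heq]
  · exact (cnt_eq_of_adj_lt₂ hpos h12 h21 hSh hS hx' hx hx'h hxh hadj.symm hgt).symm

/-! ### Hub contraction and rim transfer of walks -/

/-- A hub-free `H`-walk is a walk in any graph `G₀` containing the rim edges of `H`, with the same support. [folklore] -/
theorem toRim {H G₀ : SimpleGraph (Fin n)} (g1 : ∀ u v, H.Adj u v → u ≠ h → v ≠ h → G₀.Adj u v)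
    {u v : Fin n} (W : H.Walk u v) (hW : ∀ z ∈ W.support, z ≠ h) :
    ∃ W' : G₀.Walk u v, ∀ z ∈ W'.support, z ∈ W.support := by
  induction W with
  | nil => exact ⟨SimpleGraph.Walk.nil, fun z hz => hz⟩
  | @cons u w v huw W ih =>
    obtain ⟨W', hW'⟩ := ih (fun z hz => hW z (by simp [hz]))
    refine ⟨SimpleGraph.Walk.cons (g1 u w huw (hW u (by simp)) (hW w (by simp))) W', fun z hz => ?_⟩
    rw [SimpleGraph.Walk.support_cons, List.mem_cons] at hz ⊢
    rcases hz with hz | hz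
    · exact Or.inl hz
    · exact Or.inr (hW' z hz)

/-- HUB CONTRACTION: in a graph `H'` containing the rim edges of `H` and a chord `{u, v}` for every two rim neighbours `u ≠ v`
of the hub, every `H`-walk ending on the rim contracts to an `H'`-walk on the rim part of its support (from its start if that is a
rim vertex; from any rim neighbour `x` of the hub if the walk starts at the hub). [folklore] -/
theorem contract {H H' : SimpleGraph (Fin n)}
    (g2 : ∀ u v, H.Adj u v → u ≠ h → v ≠ h → H'.Adj u v)
    (g3 : ∀ u v, u ≠ v → u ≠ h → v ≠ h → H.Adj h u → H.Adj h v → H'.Adj u v)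
    {u v : Fin n} (W : H.Walk u v) (hv : v ≠ h) :
    (u ≠ h → ∃ W' : H'.Walk u v, ∀ z ∈ W'.support, z ∈ W.support ∧ z ≠ h) ∧
    (u = h → ∀ x, x ≠ h → H.Adj h x → ∃ W' : H'.Walk x v, ∀ z ∈ W'.support, (z = x ∨ z ∈ W.support) ∧ z ≠ h) := by
  induction W with
  | nil =>
    refine ⟨fun hu => ⟨SimpleGraph.Walk.nil, fun z hz => ?_⟩, fun hu => absurd hu hv⟩
    rw [SimpleGraph.Walk.support_nil, List.mem_singleton] at hz
    subst hz
    exact ⟨SimpleGraph.Walk.start_mem_support _, hu⟩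
  | @cons u w v huw W ih =>
    obtain ⟨ihA, ihB⟩ := ih hv
    refine ⟨fun hu => ?_, fun hu x hxh hx => ?_⟩
    · by_cases hw : w = h
      · obtain ⟨W', hW'⟩ := ihB hw u hu (hw ▸ huw.symm)
        refine ⟨W', fun z hz => ⟨?_, (hW' z hz).2⟩⟩
        rw [SimpleGraph.Walk.support_cons, List.mem_cons]
        rcases (hW' z hz).1 with hz' | hz'
        · exact Or.inl hz'
        · exact Or.inr hz'
      · obtain ⟨W', hW'⟩ := ihA hw
        refine ⟨SimpleGraph.Walk.cons (g2 u w huw hu hw) W', fun z hz => ?_⟩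
        rw [SimpleGraph.Walk.support_cons, List.mem_cons] at hz
        rw [SimpleGraph.Walk.support_cons, List.mem_cons]
        rcases hz with hz | hz
        · exact ⟨Or.inl hz, hz.symm ▸ hu⟩
        · exact ⟨Or.inr (hW' z hz).1, (hW' z hz).2⟩
    · have huw' : H.Adj h w := hu ▸ huw
      have hwh : w ≠ h := fun e => huw'.ne e.symm
      obtain ⟨W', hW'⟩ := ihA hwh
      by_cases hxw : x = w
      · subst hxw
        refine ⟨W', fun z hz => ⟨Or.inr ?_, (hW' z hz).2⟩⟩
        rw [SimpleGraph.Walk.support_cons, List.mem_cons]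
        exact Or.inr (hW' z hz).1
      · refine ⟨SimpleGraph.Walk.cons (g3 x w hxw hxh hwh hx huw') W', fun z hz => ?_⟩
        rw [SimpleGraph.Walk.support_cons, List.mem_cons] at hz
        rcases hz with hz | hz
        · exact ⟨Or.inl hz, hz.symm ▸ hxh⟩
        · refine ⟨Or.inr ?_, (hW' z hz).2⟩
          rw [SimpleGraph.Walk.support_cons, List.mem_cons]
          exact Or.inr (hW' z hz).1

/-! ### The master gap lemma for `H`-walks -/

section Master

variable {H G₀ H' : SimpleGraph (Fin n)} {a : Fin n}
  (hpos : ∀ u v, u ≠ h → v ≠ h → pos u = pos v → u = v)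
  (g1 : ∀ u v, H.Adj u v → u ≠ h → v ≠ h → G₀.Adj u v)
  (g2 : ∀ u v, H.Adj u v → u ≠ h → v ≠ h → H'.Adj u v)
  (g3 : ∀ u v, u ≠ v → u ≠ h → v ≠ h → H.Adj h u → H.Adj h v → H'.Adj u v)
  (x1 : ∀ p q r s : Fin n, H'.Adj p q → G₀.Adj r s → (pos p - pos a).val < (pos r - pos a).val →
    (pos r - pos a).val < (pos q - pos a).val → (pos q - pos a).val < (pos s - pos a).val → False)
  (x2 : ∀ p q r s : Fin n, G₀.Adj p q → H'.Adj r s → (pos p - pos a).val < (pos r - pos a).val →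
    (pos r - pos a).val < (pos q - pos a).val → (pos q - pos a).val < (pos s - pos a).val → False)
  (ha : a ≠ h)
include hpos g1 g2 g3 x1 x2 ha

/-- RIM STEP: `S ∋ a` `H`-connected from `a` inside `S`; two rim vertices outside `S` joined by an `H`-edge lie in the same gap
of the rim part `{s ∈ S | s ≠ h}` of `S` (its contraction is `H'`-connected, the tested edge is a `G₀`-edge). [folklore] -/
theorem cnt_eq_of_rimAdj {S S' : Set (Fin n)} (hS : ∀ s ∈ S, ∃ W : H.Walk a s, ∀ v ∈ W.support, v ∈ S)
    (hS' : ∀ s, s ∈ S' ↔ s ∈ S ∧ s ≠ h) {x x' : Fin n} (hx : x ∉ S) (hx' : x' ∉ S) (hxh : x ≠ h) (hx'h : x' ≠ h)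
    (hadj : H.Adj x x') :
    (Finset.univ.filter (fun s => s ∈ S' ∧ (pos s - pos a).val < (pos x - pos a).val)).card =
      (Finset.univ.filter (fun s => s ∈ S' ∧ (pos s - pos a).val < (pos x' - pos a).val)).card := by
  have hc : ∀ s ∈ S', ∃ W : H'.Walk a s, ∀ v ∈ W.support, v ∈ S' := by
    intro s hs
    obtain ⟨hsS, hsh⟩ := (hS' s).1 hs
    obtain ⟨W, hW⟩ := hS s hsS
    obtain ⟨W', hW'⟩ := (contract g2 g3 W hsh).1 ha
    exact ⟨W', fun v hv => (hS' v).2 ⟨hW v (hW' v hv).1, (hW' v hv).2⟩⟩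
  exact cnt_eq_of_adj₂ hpos x1 x2 (fun hh => ((hS' h).1 hh).2 rfl) hc (fun hx'' => hx ((hS' x).1 hx'').1)
    (fun hx'' => hx' ((hS' x').1 hx'').1) hxh hx'h (g1 x x' hadj hxh hx'h)

omit g2 ha in
/-- HUB STEP: if moreover `h ∉ S`, two distinct rim neighbours of the hub outside `S` lie in the same gap of the rim part of `S`
(`S` itself is `G₀`-connected, the tested chord is an `H'`-edge). [folklore] -/
theorem cnt_eq_of_hubAdj {S S' : Set (Fin n)} (hS : ∀ s ∈ S, ∃ W : H.Walk a s, ∀ v ∈ W.support, v ∈ S)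
    (hS' : ∀ s, s ∈ S' ↔ s ∈ S ∧ s ≠ h) (hSh : h ∉ S) {x x' : Fin n} (hx : x ∉ S) (hx' : x' ∉ S) (hxh : x ≠ h) (hx'h : x' ≠ h)
    (hxx' : x ≠ x')
    (h1 : H.Adj h x) (h2 : H.Adj h x') :
    (Finset.univ.filter (fun s => s ∈ S' ∧ (pos s - pos a).val < (pos x - pos a).val)).card =
      (Finset.univ.filter (fun s => s ∈ S' ∧ (pos s - pos a).val < (pos x' - pos a).val)).card := by
  have hc : ∀ s ∈ S', ∃ W : G₀.Walk a s, ∀ v ∈ W.support, v ∈ S' := by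
    intro s hs
    obtain ⟨hsS, -⟩ := (hS' s).1 hs
    obtain ⟨W, hW⟩ := hS s hsS
    obtain ⟨W', hW'⟩ := toRim g1 W (fun z hz e => hSh (e ▸ hW z hz))
    exact ⟨W', fun v hv => (hS' v).2 ⟨hW v (hW' v hv), fun e => hSh (e ▸ hW v (hW' v hv))⟩⟩
  exact cnt_eq_of_adj₂ hpos x2 x1 (fun hh => ((hS' h).1 hh).2 rfl) hc (fun hx'' => hx ((hS' x).1 hx'').1)
    (fun hx'' => hx' ((hS' x').1 hx'').1) hxh hx'h (g3 x x' hxx' hxh hx'h h1 h2)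

/-- MASTER LEMMA: for `S ∋ a` `H`-connected from `a` inside `S` and an `H`-walk `W` avoiding `S`, all RIM vertices of `W` lie in
the same gap of the rim part `{s ∈ S | s ≠ h}` of `S`. [folklore: discrete Jordan curve theorem, hub inside a face] -/
theorem cnt_eq_of_walk {S S' : Set (Fin n)} (hS : ∀ s ∈ S, ∃ W : H.Walk a s, ∀ v ∈ W.support, v ∈ S)
    (hS' : ∀ s, s ∈ S' ↔ s ∈ S ∧ s ≠ h) {p q : Fin n} (W : H.Walk p q) (hW : ∀ v ∈ W.support, v ∉ S) :
    ∀ u ∈ W.support, ∀ v ∈ W.support, u ≠ h → v ≠ h →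
      (Finset.univ.filter (fun s => s ∈ S' ∧ (pos s - pos a).val < (pos u - pos a).val)).card =
      (Finset.univ.filter (fun s => s ∈ S' ∧ (pos s - pos a).val < (pos v - pos a).val)).card := by
  induction W with
  | nil =>
    intro u hu v hv _ _
    rw [SimpleGraph.Walk.support_nil, List.mem_singleton] at hu hv
    rw [hu, hv]
  | @cons p p₂ q hp W ih =>
    have hpS : p ∉ S := hW p (SimpleGraph.Walk.start_mem_support _)
    have hW' : ∀ v ∈ W.support, v ∉ S := fun v hv => hW v (by simp [hv])
    have ih' := ih hW'
    -- the count of `p` (if on the rim) agrees with the count of every rim vertex of the tail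
    have key : p ≠ h → ∀ v ∈ W.support, v ≠ h →
        (Finset.univ.filter (fun s => s ∈ S' ∧ (pos s - pos a).val < (pos p - pos a).val)).card =
        (Finset.univ.filter (fun s => s ∈ S' ∧ (pos s - pos a).val < (pos v - pos a).val)).card := by
      intro hph v hv hvh
      by_cases hp₂ : p₂ = h
      · -- hub step: the walk continues `p ~ h ~ p₃`, and `h ∉ S`
        have hhS : h ∉ S := hp₂ ▸ hW' p₂ (SimpleGraph.Walk.start_mem_support _)
        cases W with
        | nil =>
          rw [SimpleGraph.Walk.support_nil, List.mem_singleton] at hv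
          exact absurd (hv.trans hp₂) hvh
        | @cons _ p₃ _ hp' W'' =>
          have h3 : H.Adj h p₃ := hp₂ ▸ hp'
          have hp₃h : p₃ ≠ h := fun e => h3.ne e.symm
          have hp₃S : p₃ ∉ S := hW' p₃ (by simp)
          have hp₃W : p₃ ∈ (SimpleGraph.Walk.cons hp' W'').support := by simp
          have e2 := ih' p₃ hp₃W v hv hp₃h hvh
          by_cases hpp₃ : p = p₃
          · rw [hpp₃]; exact e2
          · rw [← e2]
            exact cnt_eq_of_hubAdj hpos g1 g3 x1 x2 hS hS' hhS hpS hp₃S hph hp₃h hpp₃ (hp₂ ▸ hp).symm h3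
      · -- rim step
        have hp₂S : p₂ ∉ S := hW' p₂ (SimpleGraph.Walk.start_mem_support _)
        rw [cnt_eq_of_rimAdj hpos g1 g2 g3 x1 x2 ha hS hS' hpS hp₂S hph hp₂ hp]
        exact ih' p₂ (SimpleGraph.Walk.start_mem_support _) v hv hp₂ hvh
    intro u hu v hv huh hvh
    rw [SimpleGraph.Walk.support_cons, List.mem_cons] at hu hv
    rcases hu with rfl | hu <;> rcases hv with rfl | hv
    · rfl
    · exact key huh v hv hvh
    · exact (key hvh u hu huh).symm
    · exact ih' u hu v hv huh hvh

/-- The master lemma for the two ENDPOINTS of an `H`-walk avoiding `S` (both on the rim). [folklore] -/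
theorem cnt_eq_ends {S S' : Set (Fin n)} (hS : ∀ s ∈ S, ∃ W : H.Walk a s, ∀ v ∈ W.support, v ∈ S)
    (hS' : ∀ s, s ∈ S' ↔ s ∈ S ∧ s ≠ h) {p q : Fin n} (W : H.Walk p q) (hW : ∀ v ∈ W.support, v ∉ S) (hph : p ≠ h)
    (hqh : q ≠ h) :
    (Finset.univ.filter (fun s => s ∈ S' ∧ (pos s - pos a).val < (pos p - pos a).val)).card =
      (Finset.univ.filter (fun s => s ∈ S' ∧ (pos s - pos a).val < (pos q - pos a).val)).card :=
  cnt_eq_of_walk hpos g1 g2 g3 x1 x2 ha hS hS' W hW p (SimpleGraph.Walk.start_mem_support _) q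
    (SimpleGraph.Walk.end_mem_support _) hph hqh

end Master

end Apex

end Consts

end Summit.CriticalPhenomena.PercolationContinuityZ3.Theorems
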